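import Literature.MathematicalPhysics.QuantumLattice.GrassmannEffectiveActionBound
import HarnessLib

/-!
# The single-scale step in Salmhofer's `L¹–L^∞` norms: `‖𝒱'‖ ≤ e‖V‖_h / (1 - θ) · Σ_m w_m ρ^{-m}`

Topic `Literature/MathematicalPhysics/QuantumLattice`; `GrassmannEffectiveActionBound.sum_norm_kernel_effAction_le` (the
renormalisation-group step with one output label pinned) restated in the tree's kernel norms (`GrassmannKernels.lean`:
`kernelNorm ε m`, Salmhofer's / Gawȩdzki–Kupiainen's `max_p sup_x Σ_{X : X_p = x} |K(X)|`, and the weighted `actionNorm`),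
with the INPUT norms also read off `kernelNorm` (`pinnedSum_le_kernelNorm`): norm to norm, nothing else to supply.

* `pinnedSum_le_kernelNorm_one` — every pinned sum is `≤ kernelNorm 1`;
* **`kernelNorm_kernel_effAction_le`** — `kernelNorm 1 m (kernel (effAction C V) m) ≤ ρ^{-m} e‖V‖_h / (1 - θ)` for `m ≥ 1`,
  with `‖V‖_h = normV Γ κ ρ (m' ↦ kernelNorm 1 (2m') (kernel V (2m')))`, `θ = eα‖V‖_h/κ² < 1`;
* **`actionNorm_effAction_le`** — `actionNorm w 1 (effAction C V) ≤ (Σ_{1 ≤ m ≤ |Γ|} w_m ρ^{-m}) · e‖V‖_h / (1 - θ)`.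

Everything is proved; no named fact.

## Sources

G. Benfatto, A. Giuliani, V. Mastropietro, Ann. Henri Poincaré 7 (2006) 809–898, (2.13)–(2.14), (2.77)–(2.80)
(`BenfattoGiulianiMastropietro2006`); M. Salmhofer, Commun. Math. Phys. 194 (1998) 249–295, §4.1 (`Salmhofer1998`);
K. Gawȩdzki, A. Kupiainen, Comm. Math. Phys. 102 (1985) 1–30, §3 (`GawedzkiKupiainen1985GrossNeveu`).
-/

noncomputable section

namespace Literature.MathematicalPhysics.QuantumLattice

open GrassmannAlgebra Finset Literature.Probability.LatticeModels
open scoped InnerProductSpace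

variable {𝕜 : Type*} [RCLike 𝕜] {Γ : Type*} [Fintype Γ] [DecidableEq Γ] (C : Matrix Γ Γ 𝕜)

/-- Every pinned sum is dominated by the kernel norm (unit weight). [folklore] -/
theorem pinnedSum_le_kernelNorm_one {m : ℕ} (K : (Fin m → Γ) → 𝕜) (p : Fin m) (x : Γ) :
    ∑ X ∈ univ.filter (fun X : Fin m → Γ => X p = x), ‖K X‖ ≤ kernelNorm 1 m K := by
  cases m with
  | zero => exact p.elim0
  | succ m =>
    have h := pinnedSum_le_kernelNorm 1 m K p x
    rwa [one_pow, one_mul] at h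

/-- **The single-scale step in `kernelNorm`** (Benfatto–Giuliani–Mastropietro 2006, (2.13)–(2.14) with (2.77)–(2.80)):
with `‖V‖_h = normV Γ κ ρ (m' ↦ kernelNorm 1 (2m') (kernel V (2m')))` and `θ = eα‖V‖_h/κ² < 1`, the normalised partition
function is a unit and `kernelNorm 1 m (kernel (effAction C V) m) ≤ ρ^{-m} e‖V‖_h/(1-θ)` for every `m ≥ 1`.
[cite: BenfattoGiulianiMastropietro2006, (2.13)-(2.14) and (2.77)-(2.80)] -/
theorem kernelNorm_kernel_effAction_le {E : Type*} [NormedAddCommGroup E] [InnerProductSpace 𝕜 E]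
    (q : Γ → Bool) (hC : ∀ X Y, q X = q Y → C X Y = 0) (f g : Γ → E) {κ : ℝ} (hκ : 0 < κ)
    (hf : ∀ X, q X = true → ‖f X‖ ≤ κ) (hg : ∀ Y, q Y = false → ‖g Y‖ ≤ κ)
    (hG : ∀ X Y, q X = true → q Y = false → contr 𝕜 C X Y = ⟪f X, g Y⟫_𝕜)
    (V : GrassmannAlgebra 𝕜 Γ) (hV : V ∈ evenPart 𝕜 Γ) (hV0 : constPart 𝕜 V = 0)
    {α : ℝ} (hα : 0 < α) (hrow : ∀ X, ∑ Y, ‖C X Y‖ ≤ α) (hcol : ∀ Y, ∑ X, ‖C X Y‖ ≤ α) {ρ : ℝ} (hρ : 0 < ρ)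
    (hθ : Real.exp 1 * α * normV Γ κ ρ (fun m' => kernelNorm 1 (2 * m') (kernel 𝕜 V (2 * m'))) / κ ^ 2 < 1) :
    IsUnit (effPartitionFn 𝕜 C V) ∧ ∀ {m : ℕ}, 0 < m →
      kernelNorm 1 m (kernel 𝕜 (effAction 𝕜 C V) m) ≤
        ρ⁻¹ ^ m * (Real.exp 1 * normV Γ κ ρ (fun m' => kernelNorm 1 (2 * m') (kernel 𝕜 V (2 * m')))) /
          (1 - Real.exp 1 * α * normV Γ κ ρ (fun m' => kernelNorm 1 (2 * m') (kernel 𝕜 V (2 * m'))) / κ ^ 2) := by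
  set N : ℕ → ℝ := fun m' => kernelNorm 1 (2 * m') (kernel 𝕜 V (2 * m')) with hN
  have hN0 : ∀ m', 0 ≤ N m' := fun m' => kernelNorm_nonneg zero_le_one _ _
  obtain ⟨hunit, hbd⟩ := sum_norm_kernel_effAction_le C q hC f g hκ hf hg hG V hV hV0 N hN0
    (fun m' j w => pinnedSum_le_kernelNorm_one _ j w) hα hrow hcol hρ hθ
  refine ⟨hunit, @fun m hm => ?_⟩
  have hnV : 0 ≤ normV Γ κ ρ N := normV_nonneg hκ.le hρ.le hN0
  have hB : 0 ≤ ρ⁻¹ ^ m * (Real.exp 1 * normV Γ κ ρ N) / (1 - Real.exp 1 * α * normV Γ κ ρ N / κ ^ 2) :=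
    div_nonneg (by positivity) (by linarith)
  obtain ⟨m', rfl⟩ : ∃ m', m = m' + 1 := ⟨m - 1, by omega⟩
  exact kernelNorm_succ_le_of_forall 1 m' _ hB fun p x => by
    rw [one_pow, one_mul]
    exact hbd (Nat.succ_pos m') p x

/-- **The single-scale step in the weighted action norm**: for nonnegative weights `w`,
`actionNorm w 1 (effAction C V) ≤ (Σ_{1 ≤ m ≤ |Γ|} w_m ρ^{-m}) · e‖V‖_h/(1-θ)` (the degree-`0` term vanishes:
`constPart (effAction C V) = 0`). [cite: BenfattoGiulianiMastropietro2006, (2.13)-(2.14) and (2.77)-(2.80)] -/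
theorem actionNorm_effAction_le {E : Type*} [NormedAddCommGroup E] [InnerProductSpace 𝕜 E]
    (q : Γ → Bool) (hC : ∀ X Y, q X = q Y → C X Y = 0) (f g : Γ → E) {κ : ℝ} (hκ : 0 < κ)
    (hf : ∀ X, q X = true → ‖f X‖ ≤ κ) (hg : ∀ Y, q Y = false → ‖g Y‖ ≤ κ)
    (hG : ∀ X Y, q X = true → q Y = false → contr 𝕜 C X Y = ⟪f X, g Y⟫_𝕜)
    (V : GrassmannAlgebra 𝕜 Γ) (hV : V ∈ evenPart 𝕜 Γ) (hV0 : constPart 𝕜 V = 0)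
    {α : ℝ} (hα : 0 < α) (hrow : ∀ X, ∑ Y, ‖C X Y‖ ≤ α) (hcol : ∀ Y, ∑ X, ‖C X Y‖ ≤ α) {ρ : ℝ} (hρ : 0 < ρ)
    (hθ : Real.exp 1 * α * normV Γ κ ρ (fun m' => kernelNorm 1 (2 * m') (kernel 𝕜 V (2 * m'))) / κ ^ 2 < 1)
    (w : ℕ → ℝ) (hw : ∀ m, 0 ≤ w m) :
    actionNorm w 1 (effAction 𝕜 C V) ≤
      (∑ m ∈ range (Fintype.card Γ + 1), (if m = 0 then 0 else w m * ρ⁻¹ ^ m)) *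
        ((Real.exp 1 * normV Γ κ ρ (fun m' => kernelNorm 1 (2 * m') (kernel 𝕜 V (2 * m')))) /
          (1 - Real.exp 1 * α * normV Γ κ ρ (fun m' => kernelNorm 1 (2 * m') (kernel 𝕜 V (2 * m'))) / κ ^ 2)) := by
  obtain ⟨hunit, hbd⟩ := kernelNorm_kernel_effAction_le C q hC f g hκ hf hg hG V hV hV0 hα hrow hcol hρ hθ
  set B : ℝ := (Real.exp 1 * normV Γ κ ρ (fun m' => kernelNorm 1 (2 * m') (kernel 𝕜 V (2 * m')))) /
    (1 - Real.exp 1 * α * normV Γ κ ρ (fun m' => kernelNorm 1 (2 * m') (kernel 𝕜 V (2 * m'))) / κ ^ 2) with hB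
  have hwk : ∀ m, weightedKernel 1 (effAction 𝕜 C V) m = kernel 𝕜 (effAction 𝕜 C V) m := fun m => funext fun X => weightedKernel_one _ _ _
  rw [actionNorm_def, sum_mul]
  refine sum_le_sum fun m _ => ?_
  rw [hwk]
  split_ifs with hm
  · subst hm
    rw [kernelNorm_zero_left, kernel_zero, constPart_effAction 𝕜 C V hunit, norm_zero, mul_zero, zero_mul]
  · rw [mul_assoc]
    refine mul_le_mul_of_nonneg_left ?_ (hw m)
    have h := hbd (Nat.pos_of_ne_zero hm)
    rwa [mul_div_assoc] at h

end Literature.MathematicalPhysics.QuantumLattice
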